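import Summits.ResolutionOfSingularities.ResolutionOfSingularities.Theorems.MarkedTransferCampaignW13BypassRFlatInstances
import Mathlib.Tactic.LinearCombination
import HarnessLib

/-!
# [OURS · L1 W1.3] Reading R-flat, rung 1 — `RFlatTailPow` on kill test K1.3's recorded heads B / C / D, in the BOUND
# vocabulary (seat res-L1-s13-pv-1; sibling of `MarkedTransferCampaignW13BypassRFlatInstances.lean`)

LADDER-RESOLUTION rung L (rescue), cell `res-hironaka`, RESCUE-SEED slot W1.3, campaign s13 (reading R-flat by the
director's RULING 2026-08-26T20:36:49Z (2)). Kill test K1.3 (res-L1-k13, p466729 `Campaign.K13.*`, job j259562, REPRO MATCH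
j259840) certified POS («tail^q ∈ ℘(Ě,1)») on the three recorded heads for the GEOMETRIC `℘` via F-20a; this file
re-derives that column for the BOUND ALGEBRAIC `℘(Ě,1) = Campaign.pAlgPiece K (Ideal.span {g}) 2 1` (v3/v4 of the W1.3
vocabulary, p473358) through the bridge `Diff^{(1)}((g)) ⊆ ℘(Ě,1)` (`Campaign.W13.diffIdeal_le_pAlgPiece_one`, p475548),
and records v4's schema `Campaign.RFlatTailPow 2 K ((g),2) d` for every chain datum `d` (row 061/063) with `e = 1` and
the recorded tail. Helper filed `--supports stmt-ResolutionOfSingularities-15522`; PROOFS ONLY, no new objects.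

THE THREE HEADS (`p = 2`, `b = q = 2`, `e = 1`; `X 0 = x₁`, `X 1 = x₂` (resp. `x₂′`), `X 2 = y` (resp. `y′`); over any field
`K` of characteristic 2):
* B — `g = y² + x₁³x₂³`: `H = x₁³x₂³ = x₁·∂₁g` (`∂₁g = 3x₁²x₂³ = x₁²x₂³`), tail `y` (p466729 `B_hflat`).
* C — chart ring `K[x₁, x₂′, y′]` of the first blow-up (the point `ξ′_b` and its parameter `c` enter only the NEG side):
  `g′ = y′² + x₁²x₂′³`, `H♭ = x₁²x₂′³ = x₂′·∂_{x₂′}g′` (`∂_{x₂′}g′ = 3x₁²x₂′² = x₁²x₂′²`), tail `y′` (p466729 `C_identity`, `C_pos`).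
* D — `g = y² + x₁x₂³`: `H = x₁x₂³ = x₁·∂₁g` (`∂₁g = x₂³`), tail `y` (p466729 `D_hflat`, `D_pos`).

HONEST FRAMING. Nothing here is a statement of H. Hironaka's manuscript *Resolution of singularities in positive
characteristics* (2017-03-23, [Hironaka2017]); «head», «knock-out», «tail» only name the role a polynomial plays in the
recomputation (Rem 9.9–9.11 / Def 9.12 p.51, Eq. (83)–(85) pp.54–56 are CANDIDATES [claim: Hironaka2017, status:
under-review]). `Ě = ((g), 2)` is the hypersurface model of the recorded datum (as in K1.3); the identification of the
bound algebraic `℘` with the geometric one is the manuscript's candidate U17_4, NOT used. RESCUE-SEED's caveat stands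
(R-flat NON-PROPAGATING would still leave L-G4 / (127) open; barrier of record
`KangarooShadeIncrease.Hauser2003_kangarooShadeIncrease`). AI computation is weaker than expert review; nothing here is
progress on resolution of singularities in positive characteristic.

CONTENTS (all `[folklore]`, sorry-free): `tail_sq_mem_of_eq` (a head `y² + m` with `y² = g + c·∂_i g` has `y² ∈
℘(((g),2),1)`), `B_tail_sq_mem`, `B_rFlatTailPow`, `C_tail_sq_mem`, `C_rFlatTailPow`, `D_tail_sq_mem`, `D_rFlatTailPow`.
-/

noncomputable section

set_option linter.dupNamespace false -- mandated namespace of this single-conjunct summit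

namespace Summit.ResolutionOfSingularities.ResolutionOfSingularities.Theorems.Campaign.W13

open MvPolynomial
open Literature.AlgebraicGeometry.Resolution
open Literature.AlgebraicGeometry.Hironaka2017
open Literature.AlgebraicGeometry.Hironaka2017.S09LLUED (LLChainData)

/-! ## The K1.3 heads B / C / D in the bound vocabulary (`p = 2`, `b = 2`, `e = 1`; `X 0 = x₁`, `X 1 = x₂`, `X 2 = y`) -/

section HeadsBCD

variable (K : Type) [Field K] [CharP K 2]

omit [CharP K 2] in
/-- A head of the shape `g = y² + m` with `m` not involving `y` and `∂_i m·x_i = m` up to characteristic 2: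
`y² = g + x_i·∂_i g` ⇒ `y² ∈ ℘(((g),2), 1)` (bound). Used for B, C, D with the POS factorisations of K1.3. [folklore] -/
theorem tail_sq_mem_of_eq {n : ℕ} (g : MvPolynomial (Fin n) K) (y : Fin n) (i : Fin n) (c : MvPolynomial (Fin n) K)
    (h : (X y : MvPolynomial (Fin n) K) ^ 2 = g + c * pderiv i g) :
    (X y : MvPolynomial (Fin n) K) ^ 2 ^ 1 ∈ Campaign.pAlgPiece K (Ideal.span {g}) 2 1 := by
  rw [pow_one, h]
  refine diffIdeal_le_pAlgPiece_one K _ (by norm_num) (show 1 < 2 by norm_num) ?_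
  exact Ideal.add_mem _ (le_diffIdeal K 1 _ (Ideal.subset_span rfl)) (mul_pderiv_mem_diffIdeal K i _ _ le_rfl)

/-- POS_B (bound): `y² = g_B + x₁·∂₁g_B` for `g_B = y² + x₁³x₂³` (`∂₁g_B = 3x₁²x₂³ = x₁²x₂³`), so `y² ∈ ℘(Ě_B,1)`.
[folklore] -/
theorem B_tail_sq_mem :
    (X 2 : MvPolynomial (Fin 3) K) ^ 2 ^ 1 ∈
      Campaign.pAlgPiece K (Ideal.span {(X 2 ^ 2 + X 0 ^ 3 * X 1 ^ 3 : MvPolynomial (Fin 3) K)}) 2 1 := by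
  refine tail_sq_mem_of_eq K _ 2 0 (X 0) ?_
  have h2 : (2 : MvPolynomial (Fin 3) K) = 0 := CharTwo.two_eq_zero
  have h10 : (1 : Fin 3) ≠ 0 := by decide
  have h20 : (2 : Fin 3) ≠ 0 := by decide
  simp only [map_add, pderiv_mul, pderiv_pow, pderiv_X_self, pderiv_X_of_ne h10, pderiv_X_of_ne h20, mul_zero,
    zero_add, add_zero, mul_one]
  push_cast
  linear_combination (-(2 * X 0 ^ 3 * X 1 ^ 3) : MvPolynomial (Fin 3) K) * h2

/-- K1.3's B column in the bound vocabulary: `RFlatTailPow` for every chain datum with `e = 1`, tail `y`, over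
`K[x₁,x₂,y]`, `Ě_B = ((y² + x₁³x₂³), 2)`. [folklore] -/
theorem B_rFlatTailPow (d : LLChainData (MvPolynomial (Fin 3) K)) (hde : d.e = 1) (hdt : d.tail = X 2) :
    Campaign.RFlatTailPow 2 K (Ideal.span {(X 2 ^ 2 + X 0 ^ 3 * X 1 ^ 3 : MvPolynomial (Fin 3) K)}) 2 d :=
  rFlatTailPow_of_pow_mem (B_tail_sq_mem K) d hde hdt

/-- POS_C (bound), in the chart ring `K[x₁, x₂′, y′]` of the first blow-up (`X 0 = x₁`, `X 1 = x₂′`, `X 2 = y′`):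
`y′² = g′ + x₂′·∂_{x₂′}g′` for `g′ = y′² + x₁²x₂′³` (`∂_{x₂′}g′ = 3x₁²x₂′² = x₁²x₂′²`; K1.3 `C_pos`), so `y′² ∈ ℘(Ě′,1)`
with `Ě′ = ((g′), 2)` — the parameter `c` of the point `ξ′_b` is not needed for POS. [folklore] -/
theorem C_tail_sq_mem :
    (X 2 : MvPolynomial (Fin 3) K) ^ 2 ^ 1 ∈
      Campaign.pAlgPiece K (Ideal.span {(X 2 ^ 2 + X 0 ^ 2 * X 1 ^ 3 : MvPolynomial (Fin 3) K)}) 2 1 := by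
  refine tail_sq_mem_of_eq K _ 2 1 (X 1) ?_
  have h2 : (2 : MvPolynomial (Fin 3) K) = 0 := CharTwo.two_eq_zero
  have h01 : (0 : Fin 3) ≠ 1 := by decide
  have h21 : (2 : Fin 3) ≠ 1 := by decide
  simp only [map_add, pderiv_mul, pderiv_pow, pderiv_X_self, pderiv_X_of_ne h01, pderiv_X_of_ne h21, mul_zero,
    zero_add, mul_one, zero_mul]
  push_cast
  linear_combination (-(2 * X 0 ^ 2 * X 1 ^ 3) : MvPolynomial (Fin 3) K) * h2

/-- K1.3's C column in the bound vocabulary: `RFlatTailPow` for every chain datum with `e = 1`, tail `y′`, over the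
chart ring, `Ě′ = ((y′² + x₁²x₂′³), 2)`. [folklore] -/
theorem C_rFlatTailPow (d : LLChainData (MvPolynomial (Fin 3) K)) (hde : d.e = 1) (hdt : d.tail = X 2) :
    Campaign.RFlatTailPow 2 K (Ideal.span {(X 2 ^ 2 + X 0 ^ 2 * X 1 ^ 3 : MvPolynomial (Fin 3) K)}) 2 d :=
  rFlatTailPow_of_pow_mem (C_tail_sq_mem K) d hde hdt

/-- POS_D (bound): `y² = g_D + x₁·∂₁g_D` for `g_D = y² + x₁x₂³` (`∂₁g_D = x₂³`; K1.3 `D_pos`), so `y² ∈ ℘(Ě_D,1)`,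
`Ě_D = ((y² + x₁x₂³), 2)`. [folklore] -/
theorem D_tail_sq_mem :
    (X 2 : MvPolynomial (Fin 3) K) ^ 2 ^ 1 ∈
      Campaign.pAlgPiece K (Ideal.span {(X 2 ^ 2 + X 0 * X 1 ^ 3 : MvPolynomial (Fin 3) K)}) 2 1 := by
  refine tail_sq_mem_of_eq K _ 2 0 (X 0) ?_
  have h2 : (2 : MvPolynomial (Fin 3) K) = 0 := CharTwo.two_eq_zero
  have h10 : (1 : Fin 3) ≠ 0 := by decide
  have h20 : (2 : Fin 3) ≠ 0 := by decide
  simp only [map_add, pderiv_mul, pderiv_pow, pderiv_X_self, pderiv_X_of_ne h10, pderiv_X_of_ne h20, mul_zero,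
    zero_add, add_zero, one_mul]
  linear_combination (-(X 0 * X 1 ^ 3) : MvPolynomial (Fin 3) K) * h2

/-- K1.3's D column in the bound vocabulary: `RFlatTailPow` for every chain datum with `e = 1`, tail `y`, over
`K[x₁,x₂,y]`, `Ě_D = ((y² + x₁x₂³), 2)`. [folklore] -/
theorem D_rFlatTailPow (d : LLChainData (MvPolynomial (Fin 3) K)) (hde : d.e = 1) (hdt : d.tail = X 2) :
    Campaign.RFlatTailPow 2 K (Ideal.span {(X 2 ^ 2 + X 0 * X 1 ^ 3 : MvPolynomial (Fin 3) K)}) 2 d :=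
  rFlatTailPow_of_pow_mem (D_tail_sq_mem K) d hde hdt

end HeadsBCD

end Summit.ResolutionOfSingularities.ResolutionOfSingularities.Theorems.Campaign.W13

end
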